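import Summits.QuantumAdvantage.QuantumAdvantage.Theorems.OddPrimeWalkPinDialA
import Summits.QuantumAdvantage.QuantumAdvantage.Theses.OddPrimeWalk
import HarnessLib

/-!
# OddPrimeWalkPinDialB — the pinned-`𝔽₂`-degree dial on item 23109 `Theses.OddPrimeWalk.ManyReadersSqrtOdd` (decomp-qadv lens-1 g20, part B)

Exact case split of item stmt-QuantumAdvantage-23109 on `Pinnable` (part A):
* `LowPin`  = 23109 ∩ {`Pinnable`}   — PROVED (`lowPin_holds`, from part A's `win_le_of_pinnable`; none of 23109's
  `𝔽_p`-degree / density / far-read hypotheses is used; `n₀ = 0`);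
* `HighPin` = 23109 ∩ {`¬ Pinnable`} — the residual; `closes : LowPin → HighPin → ManyReadersSqrtOdd`,
  `split_of_target`, hence `target_iff_high : ManyReadersSqrtOdd ↔ HighPin` (honest record: the residual is the target
  restricted to the un-pinnable strategies — e.g. global / prefix `MOD_p` counters, which are decided elsewhere
  (`walkHardFCounter`), and the many-readers VPE core, which is not).
* `pinnable_of_hasDeg_sqrt` — member pruning: cuts of `𝔽₂`-degree `≤ ⌊√n⌋` (e.g. `⌊√n⌋`-juntas, the «permuted-local»
  strategies of 23109's docstring) are `Pinnable` with nothing pinned.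
(LAND delta per critic 72v37 (i): the local `subcubeMerge_empty` — statement twin of tree `AffBells29.subcubeMerge_empty` — is not
restated; the use site simplifies `subcubeMerge ∅` directly.)

Nothing here proves the QuantumAdvantage summit; rung currency only.
-/

set_option linter.dupNamespace false
set_option autoImplicit false

noncomputable section

namespace Summit.QuantumAdvantage.QuantumAdvantage.Theorems.PinDial

open Finset Classical
open Summit.QuantumAdvantage.AdviceFreeQNC0
open Summit.QuantumAdvantage.AdviceFreeQNC0.AffBells22
open Summit.QuantumAdvantage.AdviceFreeQNC0.Subcube

variable {n : ℕ}

open Summit.QuantumAdvantage.QuantumAdvantage.Theorems.PinDial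

/-! ## §1 The pieces of item 23109 and the exact split -/

/-- **Piece LOW** `LowPin` — item 23109 `ManyReadersSqrtOdd` VERBATIM with the extra hypothesis `Pinnable n y`.
Tags: crux-of-record · WEAKER (T restricted to a class) · DECIDED (`lowPin_holds`). -/
def LowPin : Prop :=
  ∀ (p : ℕ) [Fact p.Prime], 5 ≤ p → ∃ θ : ℝ, θ < 1 ∧ ∀ C : ℕ, ∃ n₀ : ℕ, ∀ n ≥ n₀, ∀ c : ℕ,
    ∀ y : Fin (n + 1) → (Fin n → Bool) → Bool, (∀ g, AdviceFreeQNC0.HasDegF p (y g) ((Nat.log 2 n) ^ C)) →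
    ¬ ((Finset.univ.sup fun u : Fin n → Bool => (Finset.univ.filter fun g : Fin (n + 1) => y g u = true).card) ^ 2 *
        (Nat.log 2 n) ^ (2 * C + 3) ≤ n) →
    (∀ w a : ℕ, ∀ S : Finset (Fin (n + 1)), w ≤ (Nat.log 2 n) ^ C → a + 2 ≤ n → S.card ≤ (Nat.log 2 n) ^ C →
      ∃ g : Fin (n + 1), g ∉ S ∧ (g.val + w < a ∨ a + 2 + w < g.val) ∧ ∃ u v : Fin n → Bool,
        (∀ i : Fin n, i.val ≠ a → i.val ≠ a + 1 → u i = v i) ∧ y g u ≠ y g v) →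
    Pinnable n y →
    ((Finset.univ.filter fun u : Fin n → Bool => AdviceFreeQNC0.ringWinU c y u = true).card : ℝ) ≤ θ * (2 : ℝ) ^ n

/-- **Piece HIGH** `HighPin` — item 23109 VERBATIM with the extra hypothesis `¬ Pinnable n y` (EVERY coordinate set
leaving `≥ pinFloor` coordinates free sees, under some assignment, a cut of `𝔽₂`-degree `> √free` in the free
coordinates).  Tags: residual · WEAKER-or-equal · ≡ T given `lowPin_holds` · INHABITED · leaf BARRIER (NODE-g20.md §3). -/
def HighPin : Prop :=
  ∀ (p : ℕ) [Fact p.Prime], 5 ≤ p → ∃ θ : ℝ, θ < 1 ∧ ∀ C : ℕ, ∃ n₀ : ℕ, ∀ n ≥ n₀, ∀ c : ℕ,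
    ∀ y : Fin (n + 1) → (Fin n → Bool) → Bool, (∀ g, AdviceFreeQNC0.HasDegF p (y g) ((Nat.log 2 n) ^ C)) →
    ¬ ((Finset.univ.sup fun u : Fin n → Bool => (Finset.univ.filter fun g : Fin (n + 1) => y g u = true).card) ^ 2 *
        (Nat.log 2 n) ^ (2 * C + 3) ≤ n) →
    (∀ w a : ℕ, ∀ S : Finset (Fin (n + 1)), w ≤ (Nat.log 2 n) ^ C → a + 2 ≤ n → S.card ≤ (Nat.log 2 n) ^ C →
      ∃ g : Fin (n + 1), g ∉ S ∧ (g.val + w < a ∨ a + 2 + w < g.val) ∧ ∃ u v : Fin n → Bool,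
        (∀ i : Fin n, i.val ≠ a → i.val ≠ a + 1 → u i = v i) ∧ y g u ≠ y g v) →
    ¬ Pinnable n y →
    ((Finset.univ.filter fun u : Fin n → Bool => AdviceFreeQNC0.ringWinU c y u = true).card : ℝ) ≤ θ * (2 : ℝ) ^ n

/-- **`closes`** — the two pieces decide item 23109 BY NAME (exact case split on `Pinnable`). -/
theorem closes (hL : LowPin) (hH : HighPin) : Theses.OddPrimeWalk.ManyReadersSqrtOdd := by
  intro p _ hp
  obtain ⟨θ₁, hθ₁, H₁⟩ := hL p hp
  obtain ⟨θ₂, hθ₂, H₂⟩ := hH p hp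
  refine ⟨max θ₁ θ₂, max_lt hθ₁ hθ₂, fun C => ?_⟩
  obtain ⟨n₁, hn₁⟩ := H₁ C
  obtain ⟨n₂, hn₂⟩ := H₂ C
  refine ⟨max n₁ n₂, fun n hn c y hdeg hbud hwin => ?_⟩
  have h2 : (0 : ℝ) ≤ (2 : ℝ) ^ n := by positivity
  by_cases hN : Pinnable n y
  · exact le_trans (hn₁ n (le_trans (le_max_left _ _) hn) c y hdeg hbud hwin hN)
      (mul_le_mul_of_nonneg_right (le_max_left _ _) h2)
  · exact le_trans (hn₂ n (le_trans (le_max_right _ _) hn) c y hdeg hbud hwin hN)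
      (mul_le_mul_of_nonneg_right (le_max_right _ _) h2)

/-- **Exactness**: the target gives both pieces back (each piece is `T` restricted to a class, hence WEAKER). -/
theorem split_of_target (hT : Theses.OddPrimeWalk.ManyReadersSqrtOdd) : LowPin ∧ HighPin := by
  refine ⟨fun p _ hp => ?_, fun p _ hp => ?_⟩
  · obtain ⟨θ, hθ, H⟩ := hT p hp
    refine ⟨θ, hθ, fun C => ?_⟩
    obtain ⟨n₀, h⟩ := H C
    exact ⟨n₀, fun n hn c y hdeg hbud hwin _ => h n hn c y hdeg hbud hwin⟩
  · obtain ⟨θ, hθ, H⟩ := hT p hp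
    refine ⟨θ, hθ, fun C => ?_⟩
    obtain ⟨n₀, h⟩ := H C
    exact ⟨n₀, fun n hn c y hdeg hbud hwin _ => h n hn c y hdeg hbud hwin⟩

/-! ## §2 The LOW piece is DECIDED (by the law; none of the `𝔽_p` / density / far-read hypotheses is used) -/

/-- **`lowPin_holds`**: grade LOW of the pinned-`𝔽₂`-degree dial is a theorem, for every prime `p`, with `n₀ = 0`. -/
theorem lowPin_holds : LowPin := by
  intro p _ hp
  obtain ⟨θ, hθ, hlaw⟩ := win_le_of_pinnable
  exact ⟨θ, hθ, fun C => ⟨0, fun n hn c y hdeg hbud hwin hpin => hlaw n c y hpin⟩⟩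

/-- Hence the target is decided by the HIGH piece alone … -/
theorem target_of_high (hH : HighPin) : Theses.OddPrimeWalk.ManyReadersSqrtOdd := closes lowPin_holds hH

/-- … and is EQUIVALENT to it (the residual is `T` restricted to the un-pinnable strategies; honest record:
`HighPin ≡ T` modulo the proved `LowPin`). -/
theorem target_iff_high : Theses.OddPrimeWalk.ManyReadersSqrtOdd ↔ HighPin :=
  ⟨fun hT => (split_of_target hT).2, target_of_high⟩

/-! ## §3 Member pruning: nothing pinned -/

/-- **`pinnable_of_hasDeg_sqrt`**: a strategy all of whose cuts have `𝔽₂`-degree `≤ ⌊√n⌋` (in particular every strategy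
whose cuts are `⌊√n⌋`-juntas, e.g. the «permuted-local» member `y_g = u_{g+n/2}` of 23109's docstring) is `Pinnable`
(`W = ∅`) as soon as `pinFloor ≤ n`; it falls in the DECIDED piece `LowPin`. -/
theorem pinnable_of_hasDeg_sqrt (hn : pinFloor ≤ n) (y : Fin (n + 1) → (Fin n → Bool) → Bool)
    (hy : ∀ g, HasDeg (y g) (Nat.sqrt n)) : Pinnable n y := by
  refine ⟨∅, ?_, fun a g => ?_⟩
  · simpa using hn
  · have e : (fun u => y g (subcubeMerge (∅ : Finset (Fin n)) a u)) = y g := by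
      funext u; congr 1
    rw [e]
    simpa using hy g

end Summit.QuantumAdvantage.QuantumAdvantage.Theorems.PinDial
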